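import Literature.AlgebraicGeometry.HodgeTheory.HyperplaneClassRestrictionNonzero
import Literature.AlgebraicGeometry.HodgeTheory.MiddleDimensionReductionOfHodgeModels
import Literature.AlgebraicGeometry.HodgeTheory.HypersurfaceSectionLefschetz
import Literature.AlgebraicGeometry.HodgeTheory.VanishingCohomologyNontrivialProofs
import Literature.AlgebraicGeometry.HodgeTheory.AmbientClassesMoving
import Literature.AlgebraicGeometry.HodgeTheory.GysinProjectionNonvanishing
import Literature.AlgebraicGeometry.HodgeTheory.HodgeFiltrationModelsReductionProofs
import Literature.AlgebraicGeometry.Motives.UniversalHyperplaneSection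
import Literature.AlgebraicGeometry.Motives.ProjectiveSpaceFieldPoints
import Literature.AlgebraicGeometry.Motives.ProjectiveSpaceComplexPointsOrientation
import Literature.Topology.FourManifolds.ComplexProjectiveSpaceHomologyProofs
import Literature.Topology.FourManifolds.ComplexProjectiveSpaceCohomology
import HarnessLib

/-!
# The incidence-divisor descent for algebraic classes below the middle dimension

Family `hodge`, layer `Literature/AlgebraicGeometry/HodgeTheory`. Everything here is a theorem (no
definitions, no named facts, D-0026).

Setting: `X` smooth projective of dimension `m + 1` over `ℂ`, a closed immersion `ι : X ⟶ ℙᴺ`,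
`P = (ℙᴺ)^*` the dual projective space and `emb : 𝒴 ↪ X × P` the universal hyperplane section
`𝒴 = {(x, a) | Σᵢ aᵢ xᵢ(x) = 0}` (`Motives/UniversalHyperplaneSection`; smooth projective of
dimension `m + N` by `Motives/UniversalHyperplaneSectionSmooth` and
`Motives/UniversalHyperplaneSectionIrreducible`). The main theorem
`mem_algebraicClasses_of_spread` is a DESCENT statement for the support-defined algebraic classes
`algebraicClasses = Nᵖ H²ᵖ` of the tree: **if an algebraic class `ξ ∈ Nᵖ H²ᵖ(𝒴(ℂ); ℂ)` restricts,
on one slice `X_t ↪ 𝒴` over `X × {t}` along which `H²ᵖ(X) → H²ᵖ(X_t)` is injective, to a non-zero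
multiple `r · c|_{X_t}` of a class `c ∈ H²ᵖ(X(ℂ); ℂ)`, `2p + 1 ≤ m + N`, `p ≤ N`, then `c` is
algebraic on `X`.** Its corollary `mem_algebraicClasses_of_two_mul_le_of_spread` turns a SPREADING
hypothesis over the universal family of hyperplane sections (fibrewise algebraic classes on the
smooth hyperplane sections `X_a` come from one algebraic class on `𝒴`, up to a positive multiple,
on some smooth `X_a`) plus the Hodge conjecture on smooth projective `m`-folds into the
algebraicity of rational `(p,p)`-classes with `2p ≤ m` on `(m+1)`-folds.

Relation to print. The reduction "Hodge conjecture on the hyperplane sections ⇒ Hodge conjecture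
below the middle degree" is de Cataldo–Migliorini, arXiv:0711.1307v1 §4, proof of Prop. 4.5 (i)
(p. 11) and Thomas, *Nodes and the Hodge conjecture*, §2, proof of Prop. 2, case `k < d/2` (p. 4).
Both printed proofs spread fibrewise cycles over a Lefschetz PENCIL `ℙ¹` through the relative
Hilbert scheme `Hilb(X̃/ℙ¹)` and descend through the blow-up `X̃ → X` of the base locus (the
decomposition (19) of de Cataldo–Migliorini; the pencil weak Lefschetz of Thomas). This file does
NOT formalize that pencil argument: the hypothesis `hS` of the corollary is a UNIVERSAL-FAMILY
variant of the spreading step (over the complete linear system `(ℙᴺ)^*` and its incidence variety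
`𝒴`, in the style of Voisin, *Hodge Theory II*, §3.3.1 and §10.2.1), and the descent proved here is
an ALTERNATIVE to the printed one — an incidence-divisor / coniveau-ladder argument using only the
Gysin calculus (`complexGysin`), the support calculus (`supportedClasses`) and the Lefschetz
hyperplane theorem for the ample divisor `𝒴 ⊂ X × P`; no blow-ups, no Hodge types, no rationality,
no induction on `p`.

The ladder. Let `Θ = toSegre^* h` be the class of the incidence divisor (`h ≠ 0` in `H²` of the
Segre space); `Θ` dies off `𝒴`, so `Θ = emb_*(κ · 1)` (Thom–Gysin), and `Θ = pr₁^* w + pr₂^* η` by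
Künneth with `η = Θ|_{x × P} ≠ 0` (a hyperplane class restricted to a positive-dimensional
subvariety, `HyperplaneClassRestrictionNonzero`) and `w = Θ|_{X × t}` an ambient class of `X`. If
`ξ = emb^* ζ` (weak Lefschetz for `𝒴`) then `ζ ∪ Θ = κ · emb_* ξ ∈ N^{p+1}`, hence
`Φ_j = pr_{1*}(pr₂^* η^{N-p+j} ∪ ζ ∪ Θ) ∈ N^{j+1} H^{2j+2}(X)` (ambient classes and push-forwards
preserve coniveau), while the projection formula gives `Φ_j = w ∪ π_j + π_{j+1}` for
`π_j = pr_{1*}(pr₂^* η^{N-p+j} ∪ ζ) ∈ H^{2j}(X)`; ascending induction from `π_0 ∈ H⁰ = N⁰` yields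
`π_p ∈ Nᵖ H²ᵖ(X)`, and `π_p = λ · ζ|_{X × t} = λ r · c` with `λ ≠ 0` (`pr_{1*} pr₂^* η^N = λ · 1`,
`η^N ≠ 0` in `H^{2N}(ℙᴺ)`).

Main results:

* `surjective_complexBettiMap_emb` — weak Lefschetz for the incidence divisor: `emb^*` is onto
  `Hᵏ(𝒴(ℂ))` for `k + 1 ≤ m + N` (Andreotti–Frankel for `(X × P) ∖ 𝒴`, the complement of the
  hyperplane section of the Segre-type embedding `X × P ↪ ℙ^{N²+2N}` by the incidence form);
* `mem_algebraicClasses_of_spread` — the descent;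
* `mem_algebraicClasses_of_two_mul_le_of_spread` — the corollary under the universal-family
  spreading hypothesis `hS` (not proved in the tree: it needs relative Hilbert/Chow schemes of
  `𝒴/P` and the countability argument).

The small inputs `isClosedImmersion_toSegre_left`, `map_sliceAt_map_snd_eq_zero`,
`subsingleton_complexBetti_projectiveSpace_one`, `cupProduct_map_projectiveSpace_mem_algebraicClasses`
have Summits-side twins in `Summits/HodgeConjecture/HodgeConjecture/Theorems/LinearSystemTorelliPencilReductionTopology`
(which Literature cannot import); they are restated here in their general Literature home.

## References

* [DecataldoMigliorini2009] M. A. de Cataldo, L. Migliorini, On singularities of primitive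
  cohomology classes, Proc. AMS 137 (2009) 3593–3600, §4 Prop. 4.5 and its proof
  (arXiv:0711.1307v1, pp. 10–11).
* [Thomas2005Nodes] R. P. Thomas, Nodes and the Hodge conjecture, J. Algebraic Geom. 14 (2005)
  177–185, §2 Prop. 2 and its proof (arXiv:math/0212216, p. 4).
* [VoisinHodgeII2003] C. Voisin, Hodge Theory and Complex Algebraic Geometry II (CUP 2003), §1.2.2
  Thm. 1.22–1.23, §2.1.1, §3.2.2, §6.1.1, §7.3.2.
* [FultonYoungTableaux1997] W. Fulton, Young Tableaux (CUP 1997), Appendix B §B.1 (5)–(7).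
* [HatcherAT2002] A. Hatcher, Algebraic Topology (CUP 2002), Thm. 3.15, Thm. 3.19, §3.3.
-/

noncomputable section

open scoped Manifold ContDiff
open CategoryTheory CategoryTheory.Limits AlgebraicGeometry MonoidalCategory CartesianMonoidalCategory
open Literature.AlgebraicTopology.SingularHomology
open Literature.AlgebraicGeometry.Motives

namespace Literature.AlgebraicGeometry.HodgeTheory

section HodgeTheory

-- The grading of `ℂ[z₀,…,z_M]` by homogeneous components (`Proj`, `zeroLocus`), a `def` in Mathlib.
attribute [local instance] MvPolynomial.gradedAlgebra



/-! ### Small topological inputs -/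

/-- `X × (ℙᴺ)^* → ℙᴺ × ℙᴺ → ℙ^{N²+2N}` (`ι` on the first factor, then Segre) is a closed immersion
when `ι` is. [cite: Hartshorne1977, II Ex. 5.11 and Ex. 3.11 (a)] -/
theorem isClosedImmersion_toSegre_left (N : ℕ) {X : SchemeOver ℂ} (ι : X ⟶ projectiveSpace N ℂ)
    [IsClosedImmersion ι.left] : IsClosedImmersion (toSegre N ι).left := by
  have h1 : IsClosedImmersion (ι ⊗ₘ 𝟙 (dualProjectiveSpace N ℂ)).left :=
    isClosedImmersion_tensorHom_left ι (𝟙 _)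
  have h2 : (ι ▷ dualProjectiveSpace N ℂ) = (ι ⊗ₘ 𝟙 (dualProjectiveSpace N ℂ)) :=
    (MonoidalCategory.tensorHom_id ι _).symm
  change IsClosedImmersion ((ι ▷ dualProjectiveSpace N ℂ) ≫ segreEmbedding N N ℂ).left
  rw [Over.comp_left, h2]
  infer_instance

/-- Every `ℂ`-morphism to `Spec ℂ` over `Spec ℂ` is the structure morphism (`specOver ℂ ℂ` is
terminal). [folklore] -/
private theorem eq_toSpecOver' {Y : SchemeOver ℂ} (g : Y ⟶ specOver ℂ ℂ) : g = toSpecOver Y := by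
  apply Over.OverMorphism.ext
  rw [toSpecOver_left, ← Over.w g]
  simp only [specOver, Over.mk_hom, Algebra.algebraMap_self, CommRingCat.ofHom_id, Spec.map_id]
  exact (Category.comp_id _).symm

/-- `Spec ℂ` has exactly one complex point. [folklore] -/
private theorem subsingleton_complexPoints_specOver' : Subsingleton (ComplexPoints (specOver ℂ ℂ)) :=
  ⟨fun P Q ↦ (eq_toSpecOver' P).trans (eq_toSpecOver' Q).symm⟩

/-- A morphism factoring through the point `Spec ℂ` kills `Hᵏ`, `k ≠ 0` (`Hᵏ(pt; ℂ) = 0`).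
[cite: HatcherAT2002, §3.1 p. 199] -/
theorem complexBetti_map_toSpecOver_comp_eq_zero {X Y : SchemeOver ℂ} (y : ComplexPoints Y) {k : ℕ}
    (hk : k ≠ 0) (c : complexBetti Y k) : complexBetti.map (toSpecOver X ≫ y) k c = 0 := by
  haveI := subsingleton_complexPoints_specOver'
  have h0 : IsZero (complexBetti (specOver ℂ ℂ) k) :=
    singularCochainComplex.isZero_singularCohomology_of_subsingleton' hk
  rw [complexBetti.map_comp, CategoryTheory.comp_apply, h0.eq_zero_of_tgt (complexBetti.map y k)]
  simp

/-- A class of positive degree pulled back from the parameter space `T` dies on every slice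
`X × {t}`: `s_t^* pr₂^* b = (X → Spec ℂ → T)^* b = 0`. [cite: HatcherAT2002, §3.1 p. 199] -/
theorem map_sliceAt_map_snd_eq_zero (X : SchemeOver ℂ) {T : SchemeOver ℂ} (t : ComplexPoints T)
    {j : ℕ} (hj : j ≠ 0) (b : complexBetti T j) :
    complexBetti.map (sliceAt X t) j (complexBetti.map (snd X T) j b) = 0 := by
  rw [← CategoryTheory.comp_apply, ← complexBetti.map_comp, sliceAt_snd]
  exact complexBetti_map_toSpecOver_comp_eq_zero t hj b

/-- `H¹(ℙᴺ(ℂ); ℂ) = 0` (`H₁(ℂℙᴺ; ℂ) = 0`, Hatcher Thm. 2.35 (iii) / the cell structure, and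
`H¹ ↪ Hom(H₁, ℂ)` over a field). [cite: HatcherAT2002, §3.1 Thm. 3.2 and Thm. 3.19] -/
theorem subsingleton_complexBetti_projectiveSpace_one (N : ℕ) :
    Subsingleton (complexBetti (projectiveSpace N ℂ) 1) := by
  have hz := (Literature.Topology.FourManifolds.singularHomology_complexProjectiveSpace_of_module
    ℂ ℂ N 1).2 (fun h ↦ Nat.not_even_one h.1)
  haveI := ModuleCat.subsingleton_of_isZero hz
  haveI : Subsingleton (singularCohomology ℂ ℂ
      (Literature.Topology.FourManifolds.ComplexProjectiveSpace N) 1) :=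
    (kroneckerPairing_injective_of_field ℂ
      (Literature.Topology.FourManifolds.ComplexProjectiveSpace N) 1).subsingleton
  exact (singularCohomology.mapIso ℂ ℂ
    (complexPointsProjectiveSpaceHomeomorph N) 1).toLinearEquiv.toEquiv.symm.subsingleton

/-- **Powers of a non-zero degree-`2` class of `ℙᴺ(ℂ)` are non-zero up to the dimension**:
`ηᵏ ≠ 0` in `H²ᵏ(ℙᴺ(ℂ); ℂ)` for `η ≠ 0`, `k ≤ N` (`H*(ℂℙᴺ; ℂ) = ℂ[h]/(h^{N+1})`, Hatcher
Thm. 3.19; the tree's `cupProduct_ne_zero_of_add_le`, transported along `ℙᴺ_ℂ(ℂ) ≃ₜ ℂℙᴺ`).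
[cite: HatcherAT2002, Thm. 3.19] -/
theorem cupPowTwo_ne_zero_projectiveSpace {N : ℕ} {η : complexBetti (projectiveSpace N ℂ) 2}
    (hη : η ≠ 0) {k : ℕ} (hk : k ≤ N) : cupPowTwo η k ≠ 0 := by
  let φ := complexPointsProjectiveSpaceHomeomorph N
  let f : C(Literature.Topology.FourManifolds.ComplexProjectiveSpace N, ComplexPoints (projectiveSpace N ℂ)) :=
    (φ.symm : C(_, _))
  have hinj : ∀ i, Function.Injective (singularCohomology.map ℂ ℂ f i) := fun i ↦
    ((forget (ModuleCat ℂ)).mapIso (singularCohomology.mapIso ℂ ℂ φ.symm i)).toEquiv.bijective.1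
  set η' := singularCohomology.map ℂ ℂ f 2 η with hη'def
  have hη' : η' ≠ 0 := fun h ↦ hη (hinj 2 (by rw [← hη'def, h, map_zero]))
  have key : ∀ k, k ≤ N → cupPowTwo η' k ≠ 0 := by
    intro k
    induction k with
    | zero =>
      intro _ h0
      apply hη'
      have h1 := one_cupProduct (R := ℂ) η'
      rw [cupPowTwo_zero] at h0
      rw [h0, map_zero, LinearMap.zero_apply] at h1
      exact h1.symm
    | succ k ih =>
      intro hk1
      rw [cupPowTwo_succ]
      exact Literature.Topology.FourManifolds.ComplexProjectiveSpace.cupProduct_ne_zero_of_add_le ℂ N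
        (p := k) (q := 1) _ (by omega) (ih (by omega)) hη'
  intro h0
  apply key k hk
  rw [hη'def, ← map_cupPowTwo, h0, map_zero]

/-- **Ambient classes times algebraic classes are algebraic**: for `Y` smooth projective,
`ι : Y → ℙᴺ`, `θ ∈ H^{2l}(ℙᴺ(ℂ); ℂ)` and `w ∈ Nᵏ H^{2k}(Y(ℂ); ℂ)`, the class `ι^* θ ∪ w` lies in
`N^{l+k}`: `ι^* θ` dies off the preimage of a linear subspace in general position with respect
to a support of `w` (the tree's `map_projectiveSpace_mem_iSup_ker_restrictCompl`, Eisenbud–Harris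
§1.3), and cup products multiply supports (`cupProduct_mem_supportedClasses_of_inter`).
[cite: EisenbudHarris2016, §1.3] [cite: VoisinHodgeII2003, §9.2.4 Prop. 9.20] -/
theorem cupProduct_map_projectiveSpace_mem_algebraicClasses {n N l k s : ℕ} {Y : SchemeOver ℂ}
    (hY : IsSmoothProjective n Y) (ι : Y ⟶ projectiveSpace N ℂ)
    (θ : complexBetti (projectiveSpace N ℂ) (2 * l)) {w : complexBetti Y (2 * k)}
    (hw : w ∈ algebraicClasses Y k) (hs : l + k = s) (h2 : 2 * l + 2 * k = 2 * s) :
    cupProduct h2 (complexBetti.map ι (2 * l) θ) w ∈ algebraicClasses Y s := by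
  subst hs
  obtain ⟨W, hWc, hWk, hw0⟩ := exists_support_of_mem_supportedClasses hw
  have hmem := map_projectiveSpace_mem_iSup_ker_restrictCompl hY ι hWc hWk (l := l) θ
  suffices h : (⨆ (T : Set Y.left) (_ : IsClosed T)
      (_ : ∀ t ∈ T ∩ W, ((l + k : ℕ) : ℕ∞) ≤ Order.coheight t),
      LinearMap.ker (complexBetti.restrictCompl Y T (2 * l)).hom) ≤
      (algebraicClasses Y (l + k)).comap ((cupProduct h2).flip w) by
    have h' := h hmem
    rwa [Submodule.mem_comap, LinearMap.flip_apply] at h'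
  refine iSup_le fun T ↦ iSup_le fun hT ↦ iSup_le fun hcodim ↦ fun x hx ↦ ?_
  rw [Submodule.mem_comap, LinearMap.flip_apply]
  exact cupProduct_mem_supportedClasses_of_inter hT hWc hcodim _ (LinearMap.mem_ker.1 hx) hw0


/-! ### The incidence divisor is the hyperplane section of `X × (ℙᴺ)^* ↪ ℙ^{N²+2N}` by the incidence form -/

/-- `ℓ_a` is homogeneous of degree `1`. [folklore] -/
theorem isHomogeneous_linForm (N : ℕ) (a : Fin (N + 1) → ℂ) : (linForm N a).IsHomogeneous 1 :=
  (MvPolynomial.mem_homogeneousSubmodule 1 _).1 (linForm_mem N a)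

/-- The incidence form `Σᵢ z_{(i,i)}` is the linear form `ℓ_δ` whose coefficient vector `δ` is the
indicator of the diagonal Segre coordinates. [cite: Hartshorne1977, II Ex. 5.11] -/
theorem linForm_diag_eq_incidenceForm (N : ℕ) :
    linForm (N * N + N + N) (fun j ↦ ∑ i : Fin (N + 1),
      if j = segreIndexEquiv N N (i, i) then (1 : ℂ) else 0) = incidenceForm N := by
  simp only [linForm, incidenceForm, map_sum, Finset.sum_mul]
  rw [Finset.sum_comm]
  refine Finset.sum_congr rfl fun i _ ↦ ?_
  rw [Finset.sum_eq_single (segreIndexEquiv N N (i, i))]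
  · simp
  · intro j _ hj
    simp [hj]
  · intro h
    exact absurd (Finset.mem_univ _) h

/-- The universal hyperplane `{Σᵢ z_{(i,i)} = 0} ⊆ ℙ^{N²+2N}` is the linear subspace `V₊(ℓ_δ)`.
[cite: VoisinHodgeII2003, §2.1.1] -/
theorem incidenceHyperplane_eq_linearSubspace (N : ℕ) :
    ((incidenceHyperplane N ℂ : TopologicalSpace.Closeds _) :
        Set (projectiveSpace (N * N + N + N) ℂ).left) =
      linearSubspace (N * N + N + N) (fun _ : Fin 1 ↦ fun j ↦ ∑ i : Fin (N + 1),
        if j = segreIndexEquiv N N (i, i) then (1 : ℂ) else 0) := by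
  rw [linearSubspace, Set.range_const, linForm_diag_eq_incidenceForm]
  rfl

/-- The coefficient vector `δ ≠ 0` (as a one-rowed matrix it is linearly independent). [folklore] -/
theorem linearIndependent_diagRow (N : ℕ) :
    LinearIndependent ℂ (fun _ : Fin 1 ↦ fun j : Fin (N * N + N + N + 1) ↦
      ∑ i : Fin (N + 1), if j = segreIndexEquiv N N (i, i) then (1 : ℂ) else 0) := by
  refine linearIndependent_unique_iff.2 ?_
  intro h
  have h1 := congr_fun h (segreIndexEquiv N N (0, 0))
  simp only [Pi.zero_apply] at h1
  rw [Finset.sum_eq_single (0 : Fin (N + 1)), if_pos rfl] at h1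
  · exact one_ne_zero h1
  · intro i _ hi
    rw [if_neg]
    intro h'
    exact hi (Prod.mk.inj ((segreIndexEquiv N N).injective h')).1.symm
  · intro h'
    exact absurd (Finset.mem_univ _) h'

/-- **The class of the incidence divisor dies off the incidence divisor**: for every
`a ∈ H²(ℙ^{N²+2N}(ℂ); ℂ)`, the class `toSegre^* a` on `(X × (ℙᴺ)^*)(ℂ)` restricts to zero on the
complement of `emb(𝒴)` — it is pulled back from `(ℙ^{N²+2N} ∖ {Σ z_{(i,i)} = 0})(ℂ) ≃ ℂ^{N²+2N}`,
which is acyclic. [cite: VoisinHodgeII2003, §2.1.1 and §1.2.3 Cor. 1.24] -/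
theorem restrictCompl_range_emb_map_toSegre_eq_zero (N : ℕ) {X : SchemeOver ℂ}
    (ι : X ⟶ projectiveSpace N ℂ) (a : complexBetti (projectiveSpace (N * N + N + N) ℂ) 2) :
    complexBetti.restrictCompl (X ⊗ dualProjectiveSpace N ℂ)
      (Set.range (UniversalHyperplaneSection.emb N ι).left.base) 2
        (complexBetti.map (toSegre N ι) 2 a) = 0 := by
  haveI := subsingleton_singularCohomology_complexPointsCompl_linearSubspace (m := 0)
    (linearIndependent_diagRow N) (k := 2) (by norm_num)
  have h0 := restrictCompl_preimage_map_eq_zero (toSegre N ι)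
    (linearSubspace (N * N + N + N) (fun _ : Fin 1 ↦ fun j ↦ ∑ i : Fin (N + 1),
        if j = segreIndexEquiv N N (i, i) then (1 : ℂ) else 0)) 2 a
  rw [← incidenceHyperplane_eq_linearSubspace] at h0
  rw [UniversalHyperplaneSection.range_emb]
  exact h0

/-- The complex points of the incidence divisor `emb(𝒴(ℂ)) ⊆ (X × (ℙᴺ)^*)(ℂ)` are those of the
hypersurface section of the Segre-type closed immersion `X × (ℙᴺ)^* ↪ ℙ^{N²+2N}` by the incidence
form (both closed immersions have the underlying closed set `toSegre⁻¹{Σ z_{(i,i)} = 0}`).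
[cite: VoisinHodgeII2003, §3.2.2] [cite: Hartshorne1977, II Ex. 5.11] -/
theorem range_map_emb_eq_range_map_hypersurfaceSectionι (N : ℕ) {X : SchemeOver ℂ}
    (ι : X ⟶ projectiveSpace N ℂ) [IsClosedImmersion ι.left] :
    Set.range (AlgPoints.map (L := ℂ) (UniversalHyperplaneSection.emb N ι)) =
      Set.range (AlgPoints.map (L := ℂ)
        ((⟨_, toSegre N ι, isClosedImmersion_toSegre_left N ι⟩ :
            ProjectiveEmbedding (X ⊗ dualProjectiveSpace N ℂ)).hypersurfaceSectionι
          (incidenceForm N) (isHomogeneous_incidenceForm N))) := by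
  rw [range_map_eq_setOf_pt_mem_range, range_map_eq_setOf_pt_mem_range,
    range_hypersurfaceSectionι
      (⟨_, toSegre N ι, isClosedImmersion_toSegre_left N ι⟩ :
        ProjectiveEmbedding (X ⊗ dualProjectiveSpace N ℂ))
      (incidenceForm N) (isHomogeneous_incidenceForm N) one_pos,
    UniversalHyperplaneSection.range_emb]
  rfl

/-- **Weak Lefschetz for the incidence divisor, surjective range**: for `X` with
`X × (ℙᴺ)^*` smooth projective of dimension `m + 1 + N` and the universal hyperplane section `𝒴`
smooth projective, the restriction `emb^* : Hᵏ((X × (ℙᴺ)^*)(ℂ); ℂ) → Hᵏ(𝒴(ℂ); ℂ)` is onto for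
`k + 1 ≤ m + N = dim 𝒴` — the Lefschetz hyperplane theorem (Voisin II Thm. 1.23) for the hyperplane
section `𝒴` of `X × (ℙᴺ)^* ↪ ℙ^{N²+2N}`: Andreotti–Frankel for the affine complement
(`isZero_singularHomology_compl_range_hypersurfaceSectionι`) and the duality step
(`surjective_complexBettiMap_of_isZero_singularHomology_compl_range`).
[cite: VoisinHodgeII2003, §1.2.2 Thm. 1.22–1.23] -/
theorem surjective_complexBettiMap_emb {m N : ℕ} {X : SchemeOver ℂ}
    (hXP : IsSmoothProjective (m + 1 + N) (X ⊗ dualProjectiveSpace N ℂ))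
    (ι : X ⟶ projectiveSpace N ℂ) [IsClosedImmersion ι.left] {n' : ℕ}
    (hY : IsSmoothProjective n' (universalHyperplaneSection N ι)) {k : ℕ} (hk : k + 1 ≤ m + N) :
    Function.Surjective (complexBetti.map (UniversalHyperplaneSection.emb N ι) k) := by
  have hXP' : IsSmoothProjective (m + N + 1) (X ⊗ dualProjectiveSpace N ℂ) := by
    rwa [show m + N + 1 = m + 1 + N by omega]
  have hAF := HypersurfaceSectionComplement.isZero_singularHomology_compl_range_hypersurfaceSectionι
    (R := ℂ) (M₀ := ℂ) hXP' ⟨_, toSegre N ι, isClosedImmersion_toSegre_left N ι⟩ le_rfl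
    (incidenceForm N) (isHomogeneous_incidenceForm N) (j := 2 * (m + 1 + N) - 1 - k) (by omega)
  rw [← range_map_emb_eq_range_map_hypersurfaceSectionι N ι] at hAF
  exact surjective_complexBettiMap_of_isZero_singularHomology_compl_range hXP hY
    (UniversalHyperplaneSection.emb N ι) (j := 2 * (m + 1 + N) - 1 - k) (by omega) hAF

/-! ### Künneth in degree `2` on `X × ℙᴺ`, slices and co-slices -/

/-- **Degree-`2` classes on `(X × ℙᴺ)(ℂ)` are `pr₁^* w + pr₂^* η`** (Künneth, Hatcher Thm. 3.15,
with `H⁰ = ℂ · 1` on both connected factors and `H¹(ℙᴺ(ℂ)) = 0`).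
[cite: HatcherAT2002, §3.2 Thm. 3.15 and Thm. 3.19] -/
theorem exists_eq_map_fst_add_map_snd {n N : ℕ} {X : SchemeOver ℂ} (hX : IsSmoothProjective n X)
    (Θ : complexBetti (X ⊗ dualProjectiveSpace N ℂ) 2) :
    ∃ (w : complexBetti X 2) (η : complexBetti (dualProjectiveSpace N ℂ) 2),
      Θ = complexBetti.map (fst X (dualProjectiveSpace N ℂ)) 2 w +
        complexBetti.map (snd X (dualProjectiveSpace N ℂ)) 2 η := by
  have hP : IsSmoothProjective N (dualProjectiveSpace N ℂ) := isSmoothProjective_projectiveSpace' N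
  haveI := pathConnectedSpace_complexPoints hX
  haveI := pathConnectedSpace_complexPoints hP
  haveI := subsingleton_complexBetti_projectiveSpace_one N
  refine Submodule.span_induction ?_ ?_ ?_ ?_ (kunnethSpan_complexBetti hX hP 2 Θ)
  · rintro v ⟨i, j, h, a, b, rfl⟩
    have hj2 : j ≤ 2 := by omega
    interval_cases j
    · obtain rfl : i = 2 := by omega
      obtain ⟨r, rfl⟩ := singularCohomology.exists_eq_smul_one b
      refine ⟨r • a, 0, ?_⟩
      rw [map_smul, singularCohomology.map_one, map_smul, cupProduct_one, map_smul, map_zero,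
        add_zero]
    · refine ⟨0, 0, ?_⟩
      rw [Subsingleton.elim b 0, map_zero, map_zero, map_zero, map_zero, add_zero]
    · obtain rfl : i = 0 := by omega
      obtain ⟨r, rfl⟩ := singularCohomology.exists_eq_smul_one a
      refine ⟨0, r • b, ?_⟩
      rw [map_smul, singularCohomology.map_one, map_smul, LinearMap.smul_apply, one_cupProduct,
        map_zero, zero_add, map_smul]
  · exact ⟨0, 0, by rw [map_zero, map_zero, add_zero]⟩
  · rintro x y - - ⟨w₁, η₁, rfl⟩ ⟨w₂, η₂, rfl⟩
    exact ⟨w₁ + w₂, η₁ + η₂, by rw [map_add, map_add]; abel⟩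
  · rintro r x - ⟨w₁, η₁, rfl⟩
    exact ⟨r • w₁, r • η₁, by rw [map_smul, map_smul, smul_add]⟩

/-- The slice `X × {t}` sees the `X`-component: `s_t^*(pr₁^* w + pr₂^* η) = w`.
[cite: HatcherAT2002, §3.2 Thm. 3.15] -/
theorem map_sliceAt_map_fst_add_map_snd {X T : SchemeOver ℂ} (t : ComplexPoints T) {k : ℕ}
    (hk : k ≠ 0) (w : complexBetti X k) (η : complexBetti T k) :
    complexBetti.map (sliceAt X t) k
      (complexBetti.map (fst X T) k w + complexBetti.map (snd X T) k η) = w := by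
  rw [map_add, map_sliceAt_map_snd_eq_zero X t hk η, add_zero, ← CategoryTheory.comp_apply,
    ← complexBetti.map_comp, sliceAt_fst, complexBetti.map_id]
  rfl

/-- The co-slice `{x} × T` sees the `T`-component: `({x} × T)^*(pr₁^* w + pr₂^* η) = η`.
[cite: HatcherAT2002, §3.2 Thm. 3.15] -/
theorem map_coslice_map_fst_add_map_snd {X T : SchemeOver ℂ} (x : ComplexPoints X) {k : ℕ}
    (hk : k ≠ 0) (w : complexBetti X k) (η : complexBetti T k) :
    complexBetti.map (CartesianMonoidalCategory.lift (toSpecOver T ≫ x) (𝟙 T)) k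
      (complexBetti.map (fst X T) k w + complexBetti.map (snd X T) k η) = η := by
  rw [map_add, ← CategoryTheory.comp_apply, ← complexBetti.map_comp,
    CartesianMonoidalCategory.lift_fst, complexBetti_map_toSpecOver_comp_eq_zero x hk w, zero_add,
    ← CategoryTheory.comp_apply, ← complexBetti.map_comp, CartesianMonoidalCategory.lift_snd,
    complexBetti.map_id]
  rfl

/-- **A hyperplane-type class restricts non-trivially to the co-slices `{x} × (ℙᴺ)^*`** (`N ≥ 1`):
for `ι : X ⟶ ℙᴺ` a closed immersion of a smooth projective `X`, `x ∈ X(ℂ)` and `h ≠ 0` in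
`H²(ℙ^{N²+2N}(ℂ); ℂ)`, the class `({x} × (ℙᴺ)^* ⟶ X × (ℙᴺ)^* ⟶ ℙ^{N²+2N})^* h` is non-zero — the
composite is a closed immersion of `ℙᴺ` (a section of the separated projection `pr₂`, then
`toSegre`), and non-zero degree-`2` classes of projective space restrict non-trivially to
positive-dimensional smooth closed subvarieties (`complexBetti_map_two_ne_zero_of_isClosedImmersion`).
[cite: VoisinHodgeI2002, §3.3.2 Lemma 3.16 and §7.1.2] -/
theorem complexBetti_map_coslice_toSegre_ne_zero {n N : ℕ} {X : SchemeOver ℂ}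
    (hX : IsSmoothProjective n X) (ι : X ⟶ projectiveSpace N ℂ) [IsClosedImmersion ι.left]
    (hN : 1 ≤ N) (x : ComplexPoints X) {h : complexBetti (projectiveSpace (N * N + N + N) ℂ) 2}
    (hh : h ≠ 0) :
    complexBetti.map (CartesianMonoidalCategory.lift (toSpecOver (dualProjectiveSpace N ℂ) ≫ x)
      (𝟙 (dualProjectiveSpace N ℂ)) ≫ toSegre N ι) 2 h ≠ 0 := by
  have hP : IsSmoothProjective N (dualProjectiveSpace N ℂ) := isSmoothProjective_projectiveSpace' N
  set r : dualProjectiveSpace N ℂ ⟶ X ⊗ dualProjectiveSpace N ℂ :=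
    CartesianMonoidalCategory.lift (toSpecOver (dualProjectiveSpace N ℂ) ≫ x)
      (𝟙 (dualProjectiveSpace N ℂ)) with hrdef
  haveI : IsClosedImmersion (r.left ≫ (snd X (dualProjectiveSpace N ℂ)).left) := by
    rw [← Over.comp_left, hrdef, CartesianMonoidalCategory.lift_snd, Over.id_left]
    infer_instance
  haveI : IsSeparated (snd X (dualProjectiveSpace N ℂ)).left := by
    haveI : IsProper X.hom := IsSmoothProjective.isProper_holds hX
    change IsSeparated (pullback.snd X.hom (dualProjectiveSpace N ℂ).hom)
    infer_instance
  haveI : IsClosedImmersion r.left :=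
    IsClosedImmersion.of_comp r.left (snd X (dualProjectiveSpace N ℂ)).left
  haveI := isClosedImmersion_toSegre_left N ι
  haveI : IsClosedImmersion (r ≫ toSegre N ι).left := by
    rw [Over.comp_left]
    infer_instance
  exact complexBetti_map_two_ne_zero_of_isClosedImmersion hP hN (r ≫ toSegre N ι) hh


/-! ### The Gysin calculus of the ladder -/

/-- **The fibre integral against a top-degree class**: for smooth projective `X`, `P` of dimensions
`n`, `N`, a class `ν ∈ H^{2N}(P(ℂ))` with `pr_{1*} pr₂^* ν = λ · 1`, and any `z ∈ Hᵏ((X × P)(ℂ))`,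
`pr_{1*}(pr₂^* ν ∪ z) = λ · s_t^* z` for every slice `s_t : X ≅ X × {t} ⊂ X × P` — checked on the
Künneth generators `pr₁^* b ∪ pr₂^* w` (Hatcher Thm. 3.15): for `deg w > 0` both sides vanish
(`ν ∪ w = 0` above the top degree; `s_t^* pr₂^* w = 0`), for `w = 1` both are `λ · b` by the
projection formula. [cite: FultonYoungTableaux1997, Appendix B §B.1 (5)–(7)] [cite: HatcherAT2002, §3.2 Thm. 3.15] -/
theorem complexGysin_fst_cupProduct_map_snd_top (μ : OrientationFamily) {n N : ℕ} {X T : SchemeOver ℂ}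
    (hX : IsSmoothProjective n X) (hT : IsSmoothProjective N T)
    (hXT : IsSmoothProjective (n + N) (X ⊗ T)) (t : ComplexPoints T) (ν : complexBetti T (2 * N))
    (lam : ℂ)
    (hlam : complexGysin μ hXT hX (fst X T) (show 2 * N + 2 * n = 0 + 2 * (n + N) by omega)
      (complexBetti.map (snd X T) (2 * N) ν) = lam • singularCohomology.one ℂ _)
    {k d : ℕ} (hkd : 2 * N + k = d) (hde : d + 2 * n = k + 2 * (n + N)) (z : complexBetti (X ⊗ T) k) :
    complexGysin μ hXT hX (fst X T) hde (cupProduct hkd (complexBetti.map (snd X T) (2 * N) ν) z) =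
      lam • complexBetti.map (sliceAt X t) k z := by
  have hμ : μ.HasPoincareDuality := OrientationFamily.hasPoincareDuality μ
  haveI := pathConnectedSpace_complexPoints hT
  refine Submodule.span_induction ?_ ?_ ?_ ?_ (kunnethSpan_complexBetti hX hT k z)
  · rintro v ⟨i, j, h, b, w, rfl⟩
    by_cases hj : j = 0
    · subst hj
      obtain rfl : k = i := by omega
      obtain ⟨r, rfl⟩ := singularCohomology.exists_eq_smul_one w
      rw [map_smul, singularCohomology.map_one, map_smul, cupProduct_one, map_smul, map_smul,
        map_smul, ← CategoryTheory.comp_apply (complexBetti.map (fst X T) k),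
        ← complexBetti.map_comp, sliceAt_fst, complexBetti.map_id, CategoryTheory.id_apply,
        cupProduct_gradedComm_holds ℂ _ hkd (show k + 2 * N = d by omega),
        show ((-1 : ℂ) ^ (2 * N * k)) = 1 by
          rw [show 2 * N * k = 2 * (N * k) by ring, pow_mul, neg_one_sq, one_pow], one_smul,
        complexGysin_cup hμ hXT hX (fst X T) (show k + 2 * N = d by omega) hde
          (show 2 * N + 2 * n = 0 + 2 * (n + N) by omega) (Nat.add_zero k) b, hlam, map_smul,
        cupProduct_one, smul_comm]
    · have lhs0 : cupProduct hkd (complexBetti.map (snd X T) (2 * N) ν)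
          (cupProduct h (complexBetti.map (fst X T) i b) (complexBetti.map (snd X T) j w)) = 0 := by
        haveI := subsingleton_complexBetti hT (k := 2 * N + j) (by omega)
        rw [cupProduct_gradedComm_holds ℂ _ h (show j + i = k by omega), map_smul,
          ← cupProduct_assoc rfl (show j + i = k by omega) (show 2 * N + j + i = d by omega) hkd,
          ← cupProduct_map, Subsingleton.elim (cupProduct rfl ν w) 0, map_zero, map_zero,
          LinearMap.zero_apply, smul_zero]
      rw [lhs0, map_zero, cupProduct_map, map_sliceAt_map_snd_eq_zero X t hj w, map_zero, smul_zero]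
  · rw [map_zero, map_zero, map_zero, smul_zero]
  · intro x y _ _ hx hy
    rw [map_add, map_add, hx, hy, map_add, smul_add]
  · intro r x _ hx
    rw [map_smul, map_smul, hx, map_smul, smul_comm]

/-- **The ladder identity** (projection formula): with `Θ = pr₁^* w + pr₂^* η` on `X × T`,
`pr_{1*}(pr₂^* ηᵘ ∪ (z ∪ Θ)) = w ∪ pr_{1*}(pr₂^* ηᵘ ∪ z) + pr_{1*}(pr₂^* ηᵘ⁺¹ ∪ z)` (all degrees of
`w`, `η`, `ηᵘ` even, so no signs). The degree bookkeeping is passed as hypotheses.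
[cite: FultonYoungTableaux1997, Appendix B §B.1 (3), (5), (6)] -/
theorem complexGysin_fst_cupProduct_cupPowTwo_cupProduct (μ : OrientationFamily) {n N : ℕ}
    {X T : SchemeOver ℂ} (hX : IsSmoothProjective n X) (hXT : IsSmoothProjective (n + N) (X ⊗ T))
    (w : complexBetti X 2) (η : complexBetti T 2) {Θ : complexBetti (X ⊗ T) 2}
    (hΘ : Θ = complexBetti.map (fst X T) 2 w + complexBetti.map (snd X T) 2 η)
    {dz dz2 u su su2 tu tu2 : ℕ} (hz2 : dz + 2 = dz2) (hsu : 2 * u + dz = su)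
    (hsu2 : 2 * u + dz2 = su2) (htu : su + 2 * n = tu + 2 * (n + N))
    (htu2 : su2 + 2 * n = tu2 + 2 * (n + N)) (hsu2' : 2 * (u + 1) + dz = su2) (h2 : 2 + tu = tu2)
    (z : complexBetti (X ⊗ T) dz) :
    complexGysin μ hXT hX (fst X T) htu2 (cupProduct hsu2
      (complexBetti.map (snd X T) (2 * u) (cupPowTwo η u)) (cupProduct hz2 z Θ)) =
    cupProduct h2 w (complexGysin μ hXT hX (fst X T) htu
      (cupProduct hsu (complexBetti.map (snd X T) (2 * u) (cupPowTwo η u)) z)) +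
    complexGysin μ hXT hX (fst X T) htu2
      (cupProduct hsu2' (complexBetti.map (snd X T) (2 * (u + 1)) (cupPowTwo η (u + 1))) z) := by
  have hμ : μ.HasPoincareDuality := OrientationFamily.hasPoincareDuality μ
  rw [hΘ, map_add (cupProduct hz2 z), map_add (cupProduct hsu2 _), map_add]
  congr 1
  · -- `ηᵘ ∪ (z ∪ pr₁^* w) = pr₁^* w ∪ (ηᵘ ∪ z)` and the projection formula
    rw [← cupProduct_assoc hsu hz2 (show su + 2 = su2 by omega) hsu2,
      cupProduct_gradedComm_holds ℂ _ (show su + 2 = su2 by omega) (show 2 + su = su2 by omega),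
      (even_two.mul_left su).neg_one_pow, one_smul,
      complexGysin_cup hμ hXT hX (fst X T) (show 2 + su = su2 by omega) htu2 htu h2 w]
  · -- `ηᵘ ∪ (z ∪ pr₂^* η) = ηᵘ⁺¹ ∪ z`
    rw [cupProduct_gradedComm_holds ℂ _ hz2 (show 2 + dz = dz2 by omega),
      (even_two.mul_left dz).neg_one_pow, one_smul,
      ← cupProduct_assoc (two_mul_add_two u) (show 2 + dz = dz2 by omega) hsu2' hsu2,
      ← cupProduct_map, ← cupPowTwo_succ]

/-! ### The descent -/

set_option maxHeartbeats 800000 in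
/-- **The incidence-divisor descent (the coniveau ladder).** Let `X` be smooth projective of
dimension `m + 1` with a closed immersion `ι : X ⟶ ℙᴺ`, and suppose the universal hyperplane
section `𝒴 ⊂ X × (ℙᴺ)^*` is smooth projective of dimension `m + N`. Let `ξ ∈ Nᵖ H²ᵖ(𝒴(ℂ); ℂ)` be
an algebraic class, `2p + 1 ≤ m + N`, `p ≤ N`, and suppose that on ONE slice the class `ξ` is a
non-zero multiple of `c ∈ H²ᵖ(X(ℂ); ℂ)`: there are `t ∈ (ℙᴺ)^*(ℂ)`, a morphism `u : X' ⟶ X` with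
`u^*` injective on `H²ᵖ` (weak Lefschetz for the smooth hyperplane section `X' = X_t`), a morphism
`v : X' ⟶ 𝒴` over the slice (`v ≫ emb = u ≫ s_t`) and `r ≠ 0` with `v^* ξ = r · u^* c`. Then `c` is
algebraic, `c ∈ Nᵖ H²ᵖ(X(ℂ); ℂ)`. Proof (module docstring): `ξ = emb^* ζ` (weak Lefschetz for
`𝒴`), `s_t^* ζ = r c` (injectivity of `u^*`), `Θ = toSegre^* h = emb_*(κ · 1) = pr₁^* w + pr₂^* η`
with `η ≠ 0`, `w` ambient, `ζ ∪ Θ = κ · emb_* ξ ∈ N^{p+1}`, and the ladder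
`π_{j+1} = Φ_j − w ∪ π_j`, `Φ_j ∈ N^{j+1}`, from `π_0 ∈ N⁰` up to `π_p = λ · s_t^* ζ = λ r · c ∈ Nᵖ`,
`λ ≠ 0`. An ALTERNATIVE (incidence-divisor) descent to the printed pencil/blow-up descent of
de Cataldo–Migliorini (decomposition (19)) and Thomas ("by Lefschetz"), serving the same reduction.
[cite: DecataldoMigliorini2009, §4 proof of Prop. 4.5 (arXiv v1 p. 11)]
[cite: Thomas2005Nodes, §2 proof of Prop. 2 (p. 4)]
[cite: VoisinHodgeII2003, §1.2.2 Thm. 1.23 and §6.1.1]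
[cite: FultonYoungTableaux1997, Appendix B §B.1 (5)–(7)] -/
theorem mem_algebraicClasses_of_spread {m N : ℕ} {X X' : SchemeOver ℂ}
    (hX : IsSmoothProjective (m + 1) X) (ι : X ⟶ projectiveSpace N ℂ) [IsClosedImmersion ι.left]
    (hY : IsSmoothProjective (m + N) (universalHyperplaneSection N ι)) {p : ℕ}
    (hp : 2 * p + 1 ≤ m + N) (hpN : p ≤ N) (c : complexBetti X (2 * p))
    {ξ : complexBetti (universalHyperplaneSection N ι) (2 * p)}
    (hξ : ξ ∈ algebraicClasses (universalHyperplaneSection N ι) p)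
    (t : ComplexPoints (dualProjectiveSpace N ℂ)) (u : X' ⟶ X)
    (hu : Function.Injective (complexBetti.map u (2 * p)))
    (v : X' ⟶ universalHyperplaneSection N ι)
    (hv : v ≫ UniversalHyperplaneSection.emb N ι = u ≫ sliceAt X t) {r : ℂ} (hr : r ≠ 0)
    (hvξ : complexBetti.map v (2 * p) ξ = r • complexBetti.map u (2 * p) c) :
    c ∈ algebraicClasses X p := by
  obtain ⟨d, rfl⟩ : ∃ d, N = d + p := ⟨N - p, by omega⟩
  -- the players
  have hN1 : 1 ≤ d + p := le_trans (Nat.succ_le_succ (Nat.zero_le m))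
    (le_of_isClosedImmersion_projectiveSpace hX ι)
  have hP : IsSmoothProjective (d + p) (dualProjectiveSpace (d + p) ℂ) :=
    isSmoothProjective_projectiveSpace' (d + p)
  have hXP : IsSmoothProjective (m + 1 + (d + p)) (X ⊗ dualProjectiveSpace (d + p) ℂ) :=
    IsSmoothProjective.tensor_holds hX hP
  let μ : OrientationFamily := fun _ _ hZ ↦ (ComplexPoints.isOrientableOver ℂ hZ).some
  have hμ : μ.HasPoincareDuality := OrientationFamily.hasPoincareDuality μ
  have hS := gysinMap_restrictCompl_eq_zero_of_field.{0, 0} ℂ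
  -- (1) `ξ = emb^* ζ` (weak Lefschetz for the incidence divisor)
  obtain ⟨ζ, rfl⟩ := surjective_complexBettiMap_emb hXP ι hY (k := 2 * p) (by omega) ξ
  -- (2) `s_t^* ζ = r • c`
  have hsζ : complexBetti.map (sliceAt X t) (2 * p) ζ = r • c := by
    apply hu
    rw [← CategoryTheory.comp_apply, ← complexBetti.map_comp, ← hv, complexBetti.map_comp,
      CategoryTheory.comp_apply, hvξ, map_smul]
  -- (3) the class `Θ = toSegre^* h₂` of the incidence divisor, `h₂ ≠ 0` in `H²(ℙ^{N²+2N})`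
  obtain ⟨h₂, hh₂⟩ : ∃ h₂ : complexBetti (projectiveSpace ((d + p) * (d + p) + (d + p) + (d + p)) ℂ) 2,
      h₂ ≠ 0 := by
    have h1 : Module.finrank ℂ
        (complexBetti (projectiveSpace ((d + p) * (d + p) + (d + p) + (d + p)) ℂ) 2) = 1 :=
      finrank_complexBetti_projectiveSpace_two_mul_eq_one _ (p := 1)
        (le_trans hN1 (Nat.le_add_left _ _))
    haveI := Module.nontrivial_of_finrank_eq_succ h1
    exact exists_ne 0
  set Θ : complexBetti (X ⊗ dualProjectiveSpace (d + p) ℂ) 2 :=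
    complexBetti.map (toSegre (d + p) ι) 2 h₂ with hΘdef
  -- (4) `Θ = emb_* (κ • 1)` (Thom–Gysin for the smooth divisor `𝒴`)
  have hΘsupp := restrictCompl_range_emb_map_toSegre_eq_zero (d + p) ι h₂
  obtain ⟨y, hy⟩ := exists_complexGysin_eq_of_isClosedImmersion μ hXP hY
    (UniversalHyperplaneSection.emb (d + p) ι) (a := 0) (b := 2)
    (show 0 + 2 * (m + 1 + (d + p)) = 2 + 2 * (m + (d + p)) by omega) hΘsupp
  haveI := pathConnectedSpace_complexPoints hY
  obtain ⟨κ, rfl⟩ := singularCohomology.exists_eq_smul_one y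
  -- (5) `ζ ∪ Θ = κ • emb_* (emb^* ζ) ∈ N^{p+1}`
  have hζΘ : cupProduct rfl ζ Θ ∈ algebraicClasses (X ⊗ dualProjectiveSpace (d + p) ℂ) (p + 1) := by
    have key : cupProduct rfl ζ Θ = κ • complexGysin μ hY hXP (UniversalHyperplaneSection.emb (d + p) ι)
        (show 2 * p + 2 * (m + 1 + (d + p)) = (2 * p + 2) + 2 * (m + (d + p)) by omega)
        (complexBetti.map (UniversalHyperplaneSection.emb (d + p) ι) (2 * p) ζ) := by
      rw [hΘdef, ← hy, map_smul, map_smul, ← complexGysin_cup hμ hY hXP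
        (UniversalHyperplaneSection.emb (d + p) ι) (Nat.add_zero (2 * p)) _
        (show 0 + 2 * (m + 1 + (d + p)) = 2 + 2 * (m + (d + p)) by omega) rfl ζ, cupProduct_one]
    rw [key]
    exact Submodule.smul_mem _ κ (complexGysin_mem_algebraicClasses hS μ hμ hY hXP
      (UniversalHyperplaneSection.emb (d + p) ι) (by omega) _ hξ)
  -- (6) Künneth: `Θ = pr₁^* w + pr₂^* η`; `η ≠ 0`, `w` ambient
  obtain ⟨w, η, hΘ⟩ := exists_eq_map_fst_add_map_snd hX Θ
  haveI := connectedSpace_complexPoints hX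
  obtain ⟨x₀⟩ : Nonempty (ComplexPoints X) := inferInstance
  have hη : η ≠ 0 := by
    have h := complexBetti_map_coslice_toSegre_ne_zero hX ι hN1 x₀ hh₂
    rwa [complexBetti.map_comp, CategoryTheory.comp_apply, ← hΘdef, hΘ,
      map_coslice_map_fst_add_map_snd x₀ two_ne_zero] at h
  have hw : w = complexBetti.map (sliceAt X t ≫ toSegre (d + p) ι) 2 h₂ := by
    rw [complexBetti.map_comp, CategoryTheory.comp_apply, ← hΘdef, hΘ,
      map_sliceAt_map_fst_add_map_snd t two_ne_zero]
  -- (7) `pr_{1*} pr₂^* η^N = λ • 1`, `λ ≠ 0`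
  have hηN : cupPowTwo η (d + p) ≠ 0 := cupPowTwo_ne_zero_projectiveSpace hη le_rfl
  obtain ⟨lam, hlam⟩ := exists_eq_smul_one μ hX
    (complexGysin μ hXP hX (fst X (dualProjectiveSpace (d + p) ℂ))
      (show 2 * (d + p) + 2 * (m + 1) = 0 + 2 * (m + 1 + (d + p)) by omega)
      (complexBetti.map (snd X (dualProjectiveSpace (d + p) ℂ)) (2 * (d + p)) (cupPowTwo η (d + p))))
  have hlam0 : lam ≠ 0 := by
    rintro rfl
    rw [zero_smul] at hlam
    exact complexGysin_fst_map_snd_ne_zero μ hX hP hηN hlam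
  -- (8) the ladder `π_j = pr_{1*}(pr₂^* η^{d+j} ∪ ζ) ∈ Nʲ H^{2j}(X)` for `j ≤ p`
  have ladder : ∀ j, j ≤ p →
      complexGysin μ hXP hX (fst X (dualProjectiveSpace (d + p) ℂ))
        (show 2 * (p + d + j) + 2 * (m + 1) = 2 * j + 2 * (m + 1 + (d + p)) by omega)
        (cupProduct (show 2 * (d + j) + 2 * p = 2 * (p + d + j) by omega)
          (complexBetti.map (snd X (dualProjectiveSpace (d + p) ℂ)) (2 * (d + j)) (cupPowTwo η (d + j))) ζ) ∈
      algebraicClasses X j := by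
    intro j
    induction j with
    | zero =>
      intro _
      rw [algebraicClasses_zero]
      exact Submodule.mem_top
    | succ j ih =>
      intro hj
      -- `Φ_j = pr_{1*}(pr₂^* η^{d+j} ∪ (ζ ∪ Θ)) ∈ N^{j+1}`
      have hΦ : complexGysin μ hXP hX (fst X (dualProjectiveSpace (d + p) ℂ))
          (show 2 * (p + d + j + 1) + 2 * (m + 1) = 2 * (j + 1) + 2 * (m + 1 + (d + p)) by omega)
          (cupProduct (show 2 * (d + j) + (2 * p + 2) = 2 * (p + d + j + 1) by omega)
            (complexBetti.map (snd X (dualProjectiveSpace (d + p) ℂ)) (2 * (d + j)) (cupPowTwo η (d + j)))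
            (cupProduct rfl ζ Θ)) ∈ algebraicClasses X (j + 1) :=
        complexGysin_mem_algebraicClasses hS μ hμ hXP hX (fst X (dualProjectiveSpace (d + p) ℂ))
          (by omega) _ (cupProduct_map_projectiveSpace_mem_algebraicClasses hXP
            (snd X (dualProjectiveSpace (d + p) ℂ)) (l := d + j) (cupPowTwo η (d + j)) hζΘ
            (s := p + d + j + 1) (by omega) (by omega))
      rw [complexGysin_fst_cupProduct_cupPowTwo_cupProduct μ hX hXP w η hΘ rfl
        (show 2 * (d + j) + 2 * p = 2 * (p + d + j) by omega)
        (show 2 * (d + j) + (2 * p + 2) = 2 * (p + d + j + 1) by omega)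
        (show 2 * (p + d + j) + 2 * (m + 1) = 2 * j + 2 * (m + 1 + (d + p)) by omega)
        (show 2 * (p + d + j + 1) + 2 * (m + 1) = 2 * (j + 1) + 2 * (m + 1 + (d + p)) by omega)
        (show 2 * (d + j + 1) + 2 * p = 2 * (p + d + j + 1) by omega)
        (show 2 + 2 * j = 2 * (j + 1) by omega) ζ] at hΦ
      -- `w ∪ π_j ∈ N^{j+1}` (ambient class times `Nʲ`)
      have hwπ : cupProduct (show 2 + 2 * j = 2 * (j + 1) by omega) w
          (complexGysin μ hXP hX (fst X (dualProjectiveSpace (d + p) ℂ))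
            (show 2 * (p + d + j) + 2 * (m + 1) = 2 * j + 2 * (m + 1 + (d + p)) by omega)
            (cupProduct (show 2 * (d + j) + 2 * p = 2 * (p + d + j) by omega)
              (complexBetti.map (snd X (dualProjectiveSpace (d + p) ℂ)) (2 * (d + j)) (cupPowTwo η (d + j))) ζ)) ∈
          algebraicClasses X (j + 1) := by
        rw [hw]
        exact cupProduct_map_projectiveSpace_mem_algebraicClasses hX (sliceAt X t ≫ toSegre (d + p) ι)
          (l := 1) h₂ (ih (by omega)) (by omega) (by omega)
      have h := sub_mem hΦ hwπ
      rwa [add_sub_cancel_left] at h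
  -- (9) `π_p = λ • s_t^* ζ = (λ r) • c ∈ Nᵖ`
  have hπ := ladder p le_rfl
  rw [complexGysin_fst_cupProduct_map_snd_top μ hX hP hXP t (cupPowTwo η (d + p)) lam hlam
    (show 2 * (d + p) + 2 * p = 2 * (p + d + p) by omega) _ ζ, hsζ, smul_smul] at hπ
  have h := Submodule.smul_mem _ (lam * r)⁻¹ hπ
  rwa [smul_smul, inv_mul_cancel₀ (mul_ne_zero hlam0 hr), one_smul] at h


/-! ### Below the middle dimension, from the universal-family spreading hypothesis -/

/-- **Rational `(p,p)`-classes with `2p ≤ m` on a smooth projective `(m+1)`-fold are algebraic,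
granted the Hodge conjecture on smooth projective `m`-folds, the universal-family spreading
hypothesis `hS`, and the smooth-projectivity `hU` of universal hyperplane sections (a theorem of
the tree, see below).** Here `hS` says: for `X` smooth projective of dimension `m + 1` with a projective
embedding `e : X ↪ ℙᴺ` and a rational class `c ∈ H²ᵖ(X(ℂ); ℂ)` whose restriction to EVERY smooth
`m`-dimensional hyperplane section `X_a = X ∩ {ℓ_a = 0}` is algebraic, there is an algebraic class
`ξ` on the universal hyperplane section `𝒴 ⊂ X × (ℙᴺ)^*` which on some smooth `m`-dimensional
`X_a`, mapped into `𝒴` over the slice `X × {a}` by some `v` (`v ≫ emb = (X_a ↪ X) ≫ s_a`),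
restricts to a positive integer multiple of `c|_{X_a}` — a universal-family VARIANT (complete
linear system `(ℙᴺ)^*` and incidence variety `𝒴`, Voisin II §3.3.1 / §10.2.1 style: relative
Hilbert schemes, countably many components, a dominating one) of the pencil spreading step of the
printed proofs (de Cataldo–Migliorini p. 11: "Take `Hilb(X̃/ℙ¹)` […]"; Thomas p. 4: "the relative
Hilbert Scheme […] a degree `r` multisection"); it is NOT proved in the tree. The conclusion is the
reduction those proofs establish ("it follows that `u^* a` is algebraic" / Thomas Prop. 2, case
`k < d/2`), obtained here through the alternative descent `mem_algebraicClasses_of_spread`: the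
fibrewise hypothesis of `hS` is the Hodge conjecture on the `m`-folds `X_a` (`c|_{X_a}` is rational,
`IsRationalClass.map`, and of type `(p,p)`, `preservesHodgeType_of_nonempty_hodgeModel` with
`hodgePQ_independent_of_hodgeModel_holds`, `nonempty_hodgeModel_holds`), `𝒴` is smooth projective
of dimension `m + N` for `N ≥ 2` — hypothesis `hU`, a theorem of the tree (smoothness:
`UniversalHyperplaneSection.smoothOfRelativeDimension_hom`, `Motives/UniversalHyperplaneSectionSmooth`;
geometric irreducibility: `UniversalHyperplaneSection.geometricallyIrreducible_hom`,
`Motives/UniversalHyperplaneSectionIrreducible`; projectivity: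
`UniversalHyperplaneSection.isProjectiveOver`), kept as a hypothesis only to keep this file's
imports light; `N ≥ m + 1 ≥ 3` when `p ≥ 1` — `H²ᵖ(X) → H²ᵖ(X_a)` is injective for `2p ≤ m`
(`injective_complexBettiMap_hypersurfaceSection`), and `p = 0` is `algebraicClasses_zero`.
[cite: DecataldoMigliorini2009, §4 Prop. 4.5 (i) and its proof (arXiv v1 pp. 10–11)]
[cite: Thomas2005Nodes, §2 Prop. 2 and its proof, case k < d/2 (p. 4)]
[cite: VoisinHodgeII2003, §1.2.2 Thm. 1.23, §3.3.1, §10.2.1] -/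
theorem mem_algebraicClasses_of_two_mul_le_of_spread
    (hS : ∀ ⦃m : ℕ⦄ ⦃X : SchemeOver ℂ⦄ (_ : IsSmoothProjective (m + 1) X)
      (e : ProjectiveEmbedding X) (p : ℕ) (c : complexBetti X (2 * p)), IsRationalClass c →
      (∀ (a : Fin (e.n + 1) → ℂ), a ≠ 0 →
        IsSmoothProjective m (e.hypersurfaceSection (linForm e.n a) (isHomogeneous_linForm e.n a)) →
        complexBetti.map (e.hypersurfaceSectionι (linForm e.n a) (isHomogeneous_linForm e.n a))
          (2 * p) c ∈
          algebraicClasses (e.hypersurfaceSection (linForm e.n a) (isHomogeneous_linForm e.n a)) p) →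
      ∃ ξ : complexBetti (universalHyperplaneSection e.n e.ι) (2 * p),
        ξ ∈ algebraicClasses (universalHyperplaneSection e.n e.ι) p ∧
        ∃ (a : Fin (e.n + 1) → ℂ) (ha : a ≠ 0),
          IsSmoothProjective m (e.hypersurfaceSection (linForm e.n a) (isHomogeneous_linForm e.n a)) ∧
          ∃ (r : ℕ) (v : e.hypersurfaceSection (linForm e.n a) (isHomogeneous_linForm e.n a) ⟶
              universalHyperplaneSection e.n e.ι),
            0 < r ∧
            v ≫ UniversalHyperplaneSection.emb e.n e.ι =
              e.hypersurfaceSectionι (linForm e.n a) (isHomogeneous_linForm e.n a) ≫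
                sliceAt X (ProjectiveSpace.pointOfVec ℂ a ha) ∧
            complexBetti.map v (2 * p) ξ =
              (r : ℂ) • complexBetti.map (e.hypersurfaceSectionι (linForm e.n a)
                (isHomogeneous_linForm e.n a)) (2 * p) c)
    (hU : ∀ ⦃m N : ℕ⦄ ⦃X : SchemeOver ℂ⦄, IsSmoothProjective (m + 1) X →
      ∀ (ι : X ⟶ projectiveSpace N ℂ) [IsClosedImmersion ι.left], 2 ≤ N →
        IsSmoothProjective (m + N) (universalHyperplaneSection N ι))
    ⦃m : ℕ⦄ ⦃X : SchemeOver ℂ⦄ (hX : IsSmoothProjective (m + 1) X)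
    (hHC : ∀ ⦃Y : SchemeOver ℂ⦄, IsSmoothProjective m Y → ∀ (q : ℕ) (c : complexBetti Y (2 * q)),
      IsRationalClass c → IsOfHodgeType m Y (2 * q) q q c → c ∈ algebraicClasses Y q)
    (p : ℕ) (c : complexBetti X (2 * p)) (hpm : 2 * p ≤ m) (hc : IsRationalClass c)
    (hpp : IsOfHodgeType (m + 1) X (2 * p) p p c) : c ∈ algebraicClasses X p := by
  rcases Nat.eq_zero_or_pos p with rfl | hp0
  · rw [algebraicClasses_zero]
    exact Submodule.mem_top
  obtain ⟨N, ι, hι⟩ := hX.isProjectiveOver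
  let e : ProjectiveEmbedding X := ⟨N, ι, hι⟩
  have hfib : ∀ (a : Fin (e.n + 1) → ℂ), a ≠ 0 →
      IsSmoothProjective m (e.hypersurfaceSection (linForm e.n a) (isHomogeneous_linForm e.n a)) →
      complexBetti.map (e.hypersurfaceSectionι (linForm e.n a) (isHomogeneous_linForm e.n a))
        (2 * p) c ∈
        algebraicClasses (e.hypersurfaceSection (linForm e.n a) (isHomogeneous_linForm e.n a)) p :=
    fun a _ hXa ↦ hHC hXa p _ (hc.map _)
      (preservesHodgeType_of_nonempty_hodgeModel hodgePQ_independent_of_hodgeModel_holds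
        nonempty_hodgeModel_holds hXa hX _ hpp)
  obtain ⟨ξ, hξ, a, ha, hXa, r, v, hr, hv, hvξ⟩ := hS hX e p c hc hfib
  have hN : m + 1 ≤ e.n := le_of_isClosedImmersion_projectiveSpace hX e.ι
  have hY : IsSmoothProjective (m + e.n) (universalHyperplaneSection e.n e.ι) := hU hX e.ι (by omega)
  exact mem_algebraicClasses_of_spread hX e.ι hY (by omega) (by omega) c hξ
    (ProjectiveSpace.pointOfVec ℂ a ha) _
    (injective_complexBettiMap_hypersurfaceSection hX e le_rfl (linForm e.n a)
      (isHomogeneous_linForm e.n a) hXa hpm) v hv (r := (r : ℂ)) (Nat.cast_ne_zero.2 hr.ne') hvξ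

end HodgeTheory

end Literature.AlgebraicGeometry.HodgeTheory

end
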